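import HarnessLib
import Summits.Langlands.Langlands.Theses.SkinnerWilesDefectOne

/-!
# `BianchiCongruenceCohomologyFinite` (stmt-Langlands-15362) — Negative knowledge: the finiteness of
# the coefficient module is load-bearing; degree `0` is free; the binders are jointly satisfiable

Refuter crux-attack (2026-08-16) on the crux
`∀ K imaginary quadratic, ∀ U ≤ GL₂(𝔸_K^∞) compact open, ∀ A : Rep ℤ (GL₂(K) ∩ U) finite, ∀ q,
Finite (groupCohomology A q)` (Borel–Serre finiteness for Bianchi congruence subgroups — a theorem in
print, so no `¬`-theorem of the crux itself is expected; these lemmas fence the statement for its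
provers):

* `finite_groupCohomology_zero` — for ANY group and any representation with finite carrier,
  `H⁰ = A^G ↪ A` is finite: the degree `q = 0` of the crux is free, its content starts at `q = 1`.
* `not_finite_groupCohomology_zero_trivial_int` — `H⁰(G, ℤ) = ℤ` is infinite.
* `finrank_cyclotomicField_three`, `isTotallyComplex_cyclotomicField_three` — `ℚ(ζ₃) = ℚ(√-3)`
  meets the field binders; with `U = GL₂(𝒪̂_K)` (`isOpen_glFiniteIntegralLevel`,
  `isCompact_glFiniteIntegralLevel_holds`) the hypotheses of the crux are jointly satisfiable.
* `bianchiCongruenceCohomologyFinite_false_without_finite` — drop `Finite A` and the statement is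
  FALSE (trivial coefficients `ℤ`, `q = 0`, at `K = ℚ(ζ₃)`, `U = GL₂(𝒪̂_K)`): any proof must use the
  finiteness of the coefficients (for finitely generated coefficients only finite generation of
  `H^q` holds, Brown, Cohomology of Groups, VIII (5.1) and VIII.4).

Elaboration note for provers (met while writing these): for `A : Rep ℤ G` do not re-type
`A.ρ.invariants` by hand — instance synthesis finds `AddCommGroup.toIntModule` where the structure
field `A.hV2` is expected (a `ℤ`-module diamond); go through `(groupCohomology.H0Iso A).toLinearEquiv`
and `Subtype.val` instead. No statement of the route is used or asserted. [folklore]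
-/

set_option linter.dupNamespace false -- project-wide option (lakefile weak.linter.dupNamespace); `Summit.Langlands.Langlands` is the mandated namespace

open CategoryTheory NumberField
open Literature.NumberTheory.Automorphic

namespace Summit.Langlands.Langlands.Theorems.BianchiCongruenceCohomologyFinite.Negative

/-! ### Degree zero is free -/

/-- `H⁰(G, A) ≅ A^G ↪ A` (`groupCohomology.H0Iso`): for a representation with finite carrier the
degree-`0` cohomology is finite, for every group `G`. [folklore] -/
theorem finite_groupCohomology_zero {G : Type} [Group G] (A : Rep ℤ G) (hA : Finite A) :
    Finite (groupCohomology A 0) := by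
  let e := (groupCohomology.H0Iso A).toLinearEquiv
  haveI : Finite A.V := hA
  exact Finite.of_injective (fun x => Subtype.val (e x)) (Subtype.val_injective.comp e.injective)

/-- `H⁰(G, ℤ) = ℤ` (`groupCohomology.H0IsoOfIsTrivial`) is infinite, for every group `G`. [folklore] -/
theorem not_finite_groupCohomology_zero_trivial_int (G : Type) [Group G] :
    ¬ Finite (groupCohomology (Rep.trivial ℤ G ℤ) 0) := by
  intro h
  have e := groupCohomology.H0IsoOfIsTrivial (Rep.trivial ℤ G ℤ)
  have : Finite (ModuleCat.of ℤ (Rep.trivial ℤ G ℤ).V) := Finite.of_equiv _ e.toLinearEquiv.toEquiv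
  have : Finite ℤ := this
  exact not_finite ℤ

/-! ### The field binders are met by `ℚ(ζ₃) = ℚ(√-3)` -/

/-- `[ℚ(ζ₃) : ℚ] = 2` for the canonical `ℚ`-algebra structure `algebraRat` used by the crux
(`IsCyclotomicExtension.Rat.finrank`, transported along `Subsingleton (Algebra ℚ _)`). [folklore] -/
theorem finrank_cyclotomicField_three : Module.finrank ℚ (CyclotomicField 3 ℚ) = 2 := by
  obtain ⟨A, hA⟩ : ∃ A : Algebra ℚ (CyclotomicField 3 ℚ),
      @IsCyclotomicExtension {3} ℚ (CyclotomicField 3 ℚ) _ _ A :=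
    ⟨_, CyclotomicField.isCyclotomicExtension 3 ℚ⟩
  have hAeq : A = (DivisionRing.toRatAlgebra : Algebra ℚ (CyclotomicField 3 ℚ)) :=
    Subsingleton.elim _ _
  subst hAeq
  haveI := hA
  rw [IsCyclotomicExtension.Rat.finrank 3 (CyclotomicField 3 ℚ)]
  decide

/-- `ℚ(ζ₃)` is totally complex (`IsCyclotomicExtension.Rat.isTotallyComplex`). [folklore] -/
theorem isTotallyComplex_cyclotomicField_three : IsTotallyComplex (CyclotomicField 3 ℚ) := by
  obtain ⟨A, hA⟩ : ∃ A : Algebra ℚ (CyclotomicField 3 ℚ),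
      @IsCyclotomicExtension {3} ℚ (CyclotomicField 3 ℚ) _ _ A :=
    ⟨_, CyclotomicField.isCyclotomicExtension 3 ℚ⟩
  have hAeq : A = (DivisionRing.toRatAlgebra : Algebra ℚ (CyclotomicField 3 ℚ)) :=
    Subsingleton.elim _ _
  subst hAeq
  haveI := hA
  exact IsCyclotomicExtension.Rat.isTotallyComplex (n := 3) (CyclotomicField 3 ℚ) (by norm_num)

/-! ### Load-bearing: finiteness of the coefficients -/

/-- **Any proof of `BianchiCongruenceCohomologyFinite` must use `Finite A`.** With the finiteness of
the coefficient module dropped the statement is false: at `K = ℚ(ζ₃)` (imaginary quadratic),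
`U = GL₂(𝒪̂_K)` (compact open: `isOpen_glFiniteIntegralLevel`, `isCompact_glFiniteIntegralLevel_holds`),
`A = ℤ` with trivial action and `q = 0`, `H⁰(Γ_U, ℤ) = ℤ` is infinite. (For coefficients finitely
generated over `ℤ` only finite generation of `H^q(Γ_U, A)` holds.) [folklore] -/
theorem bianchiCongruenceCohomologyFinite_false_without_finite :
    ¬ ∀ (K : Type) [Field K] [NumberField K], Module.finrank ℚ K = 2 → IsTotallyComplex K →
        ∀ (U : Subgroup (BigHeckeGLn.FiniteAdelicGL 2 K)),
          IsOpen (U : Set (BigHeckeGLn.FiniteAdelicGL 2 K)) →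
          IsCompact (U : Set (BigHeckeGLn.FiniteAdelicGL 2 K)) →
          ∀ (A : Rep ℤ (U.comap (BigHeckeGLn.globalEmbedding 2 K))) (q : ℕ),
            Finite (groupCohomology A q) := fun h =>
  not_finite_groupCohomology_zero_trivial_int _ (h (CyclotomicField 3 ℚ)
    finrank_cyclotomicField_three isTotallyComplex_cyclotomicField_three (glFiniteIntegralLevel 2 _)
    (isOpen_glFiniteIntegralLevel 2 _) (isCompact_glFiniteIntegralLevel_holds 2 _)
    (Rep.trivial ℤ _ ℤ) 0)

/-- The crux in degree `0` holds outright (so no refutation can come from `q = 0`; combine with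
`bianchiCongruenceCohomologyFinite_false_without_finite`: the pair (`Finite A`, `q ≥ 1`) is where the
content lives). [folklore] -/
theorem bianchiCongruenceCohomologyFinite_degree_zero (K : Type) [Field K] [NumberField K]
    (U : Subgroup (BigHeckeGLn.FiniteAdelicGL 2 K))
    (A : Rep ℤ (U.comap (BigHeckeGLn.globalEmbedding 2 K))) (hA : Finite A) :
    Finite (groupCohomology A 0) :=
  finite_groupCohomology_zero A hA

end Summit.Langlands.Langlands.Theorems.BianchiCongruenceCohomologyFinite.Negative
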